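import Mathlib.GroupTheory.GroupAction.Basic
import Mathlib.GroupTheory.GroupAction.Quotient
import Mathlib.SetTheory.Cardinal.Finite
import Mathlib.Data.Finite.Sum
import Mathlib.Data.Finite.Prod
import Mathlib.Data.Setoid.Basic
import HarnessLib

/-!
# Counting orbits on an invariant tube: «per period, off-axis vertices = off-axis edges»
(Serre, *Trees* (1980), I.6.4 Prop. 24 (a hyperbolic automorphism has an axis; nearest-point retraction onto it); Kottwitz, *Tamagawa numbers* (1988), §2:
the orbital integral of the Euler–Poincaré function at a NON-elliptic element is `0` = «vertices − edges per period of the split torus on the tube of fixed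
points about its axis»)

Topic `GroupTheory`; namespace `Literature.GroupTheory`.  THEOREMS ONLY (no definition, no instance, no notation, no named fact, no `sorry`); Mathlib-only.
Cell `pub/hodgecm-mathlib`, F0∕P3a, crux H413 = stmt-HodgeConjecture-24833, line «N6nsGerm» residual `stub_N6nsR2EP`, (R2) Euler–Poincaré road, RAMIFIED half
census `F0/P3a/A-p06/g27/CENSUS-R2ram-RamifiedEulerPoincare.A-p06g27.md` §4 (N2a) (LEAD F0P3a-plan (g10) T9-6 (2) ∕ T9-8 (B); co-hand A-p17 (g22); seat A-p06 (g27)).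
HONEST LABEL: HC_CM is proved only modulo the printed citations until rung 0 closes; this file is pure orbit counting and asserts nothing printed.

THE MATHEMATICS.  A group `Φ` acts on two types `𝓐`, `𝓑` («the two vertex types of a bipartite graph») compatibly with an adjacency relation
`adj : 𝓑 → 𝓐 → Prop` (a FLAG is an adjacent ordered pair `(b, a)`).  Inside `Φ`-invariant sets of «fixed» vertices `F_𝓐, F_𝓑` sit `Φ`-invariant «axis» sets
`Y_𝓐 ⊆ F_𝓐`, `Y_𝓑 ⊆ F_𝓑`, and every off-axis fixed vertex has a `Φ`-EQUIVARIANT PARENT of the other type, adjacent, fixed, one step closer to the axis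
(heights `h_𝓐, h_𝓑`), such that EVERY fixed flag not inside the axis is a parent flag (this is where «the graph is a tree and `F` is a subtree containing the
connected axis» enters — Serre's nearest-point retraction; here it is an INPUT).  Then «child ↦ (child, parent)» is a `Φ`-equivariant bijection
`(F_𝓐 ∖ Y_𝓐) ⊔ (F_𝓑 ∖ Y_𝓑) ≃ {fixed flags not in the axis}`, so, counting `Φ`-ORBITS («per period» when `Φ = τ^ℤ` is the translation lattice of a split torus),
**`#(F_𝓐∕Φ) + #(F_𝓑∕Φ) + #(axis flags∕Φ) = #(fixed flags∕Φ) + #(Y_𝓐∕Φ) + #(Y_𝓑∕Φ)`**.  With the axis count `#(Y_𝓐∕Φ) + #(Y_𝓑∕Φ) = #(axis flags∕Φ)`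
(a bi-infinite path modulo a translation: as many vertices as edges per period) this is Kottwitz's «vertices − edges = 0» — the binder `hN` of ★ p842588
`RankOneEulerPoincareGlue` once ★ p842951 `OrbitalIntegralFixedPointsPerPeriodQuotient` has turned each `ν(C)⁻¹Φ(⟦γ⟧, 1_C)` into `#(Fix_γ(G⧸C)∕A)`.
Orbit counts are typed choice-free as `Nat.card (Quotient ((MulAction.orbitRel Φ X).comap (Subtype.val : S → X)))` («`#(S∕Φ)`», `S ⊆ X` any subset; an orbit
through a point of an invariant `S` stays in `S`) — the currency of ★ p842951.

* §1 transfer lemmas for `#(S∕Φ)`: `…_eq_of_bijective` (equivariant bijection `S ≃ S′` across two `Φ`-types), `finite_…_of_subset` (`T ⊆ S`),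
  `…_union` (`#((S₁ ⊔ S₂)∕Φ) = #(S₁∕Φ) + #(S₂∕Φ)` for `S₁` invariant, disjoint, both finite).
* §2 **`natCard_quotient_tube`** — the displayed identity (hypotheses listed on the theorem; finiteness of `#(F_𝓐∕Φ)`, `#(F_𝓑∕Φ)`, `#(fixed flags∕Φ)` assumed —
  supplied in the application by ★ `finite_quotient_orbitRel_fixedBy_of_isClosed`).

## References
* [Serre1980Trees] J.-P. Serre, *Trees*, Springer (1980): I.6.4 Prop. 24–25 (axis of a hyperbolic automorphism; projection onto a subtree), II.1.1.
* [Kottwitz1988] R. E. Kottwitz, *Tamagawa numbers*, Ann. of Math. 127 (1988), §2 Theorem 2 (non-elliptic case).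
* [Laumon1995] G. Laumon, *Cohomology of Drinfeld Modular Varieties* I (1996), Lemma (5.3.2) p. 136 (orbital integrals as counts of fixed facets modulo the
  centraliser).
-/

set_option autoImplicit false

namespace Literature.GroupTheory

/-! ## §1 Transfer lemmas for `#(S ∕ Φ) = Nat.card (Quotient ((orbitRel Φ X).comap (Subtype.val : S → X)))` -/

section Transfer

variable {Φ : Type*} [Group Φ] {X X' : Type*} [MulAction Φ X] [MulAction Φ X']

/-- The restricted orbit relation on `S ⊆ X`: `s ~ t ↔ ∃ φ, φ · t = s`. [cite: Serre1980Trees, I.6.4] -/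
theorem orbitRel_comap_subtype_iff (S : Set X) (s t : S) :
    (MulAction.orbitRel Φ X).comap (Subtype.val : S → X) s t ↔ ∃ φ : Φ, φ • (t : X) = s := by
  rw [Setoid.comap_rel, MulAction.orbitRel_apply, MulAction.mem_orbit_iff]

/-- **Transfer along an equivariant bijection**: if `f : S → S′` is a bijection with `(∃ φ, φ·t = s) ↔ (∃ φ, φ·f t = f s)`, then `#(S∕Φ) = #(S′∕Φ)` and one is finite iff
the other is. [cite: Serre1980Trees, I.6.4] -/
theorem natCard_quotient_orbitRel_comap_eq_of_bijective (S : Set X) (S' : Set X') (f : S → S') (hf : Function.Bijective f)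
    (hrel : ∀ s t : S, (∃ φ : Φ, φ • (t : X) = s) ↔ (∃ φ : Φ, φ • (f t : X') = f s)) :
    Nat.card (Quotient ((MulAction.orbitRel Φ X).comap (Subtype.val : S → X))) =
        Nat.card (Quotient ((MulAction.orbitRel Φ X').comap (Subtype.val : S' → X'))) ∧
      (Finite (Quotient ((MulAction.orbitRel Φ X).comap (Subtype.val : S → X))) ↔
        Finite (Quotient ((MulAction.orbitRel Φ X').comap (Subtype.val : S' → X')))) := by
  set R := (MulAction.orbitRel Φ X).comap (Subtype.val : S → X) with hR
  set R' := (MulAction.orbitRel Φ X').comap (Subtype.val : S' → X') with hR'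
  have hresp : ∀ a b : S, R a b → R' (f a) (f b) := fun a b h => by
    rw [hR, orbitRel_comap_subtype_iff] at h
    rw [hR', orbitRel_comap_subtype_iff]
    exact (hrel a b).1 h
  let F : Quotient R → Quotient R' := Quotient.map f hresp
  have hF : Function.Bijective F := by
    refine ⟨fun p q h => ?_, fun q => ?_⟩
    · induction p using Quotient.inductionOn with
      | h a =>
        induction q using Quotient.inductionOn with
        | h b =>
          have h' : R' (f a) (f b) := Quotient.exact h
          rw [hR', orbitRel_comap_subtype_iff] at h'
          exact Quotient.sound ((orbitRel_comap_subtype_iff S a b).2 ((hrel a b).2 h'))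
    · induction q using Quotient.inductionOn with
      | h b' =>
        obtain ⟨b, rfl⟩ := hf.2 b'
        exact ⟨Quotient.mk R b, rfl⟩
  exact ⟨Nat.card_eq_of_bijective F hF, ⟨fun _ => Finite.of_surjective F hF.2, fun _ => Finite.of_injective F hF.1⟩⟩

/-- **Sub-quotients of a finite orbit quotient are finite**: for `T ⊆ S ⊆ X`, `#(S∕Φ)` finite ⇒ `#(T∕Φ)` finite (the induced map `T∕Φ → S∕Φ` is injective).
[cite: Serre1980Trees, I.6.4] -/
theorem finite_quotient_orbitRel_comap_of_subset {S T : Set X} (hTS : T ⊆ S)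
    (hS : Finite (Quotient ((MulAction.orbitRel Φ X).comap (Subtype.val : S → X)))) :
    Finite (Quotient ((MulAction.orbitRel Φ X).comap (Subtype.val : T → X))) := by
  set R := (MulAction.orbitRel Φ X).comap (Subtype.val : S → X) with hR
  set RT := (MulAction.orbitRel Φ X).comap (Subtype.val : T → X) with hRT
  let ι : T → S := fun t => ⟨t, hTS t.2⟩
  have hresp : ∀ a b : T, RT a b → R (ι a) (ι b) := fun a b h => by
    rw [hRT, orbitRel_comap_subtype_iff] at h
    rw [hR, orbitRel_comap_subtype_iff]
    exact h
  refine Finite.of_injective (Quotient.map ι hresp) fun p q h => ?_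
  induction p using Quotient.inductionOn with
  | h a =>
    induction q using Quotient.inductionOn with
    | h b =>
      have h' : R (ι a) (ι b) := Quotient.exact h
      rw [hR, orbitRel_comap_subtype_iff] at h'
      exact Quotient.sound ((orbitRel_comap_subtype_iff T a b).2 h')

/-- **Additivity on an invariant disjoint union**: for `S₁, S₂ ⊆ X` disjoint with `S₁` invariant under `Φ` and both quotients finite,
`#((S₁ ∪ S₂)∕Φ) = #(S₁∕Φ) + #(S₂∕Φ)` (and the union's quotient is finite). [cite: Serre1980Trees, I.6.4] -/
theorem natCard_quotient_orbitRel_comap_union (S₁ S₂ : Set X) (hdisj : Disjoint S₁ S₂) (hinv : ∀ (φ : Φ) (x : X), x ∈ S₁ → φ • x ∈ S₁)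
    (h₁ : Finite (Quotient ((MulAction.orbitRel Φ X).comap (Subtype.val : S₁ → X))))
    (h₂ : Finite (Quotient ((MulAction.orbitRel Φ X).comap (Subtype.val : S₂ → X)))) :
    Finite (Quotient ((MulAction.orbitRel Φ X).comap (Subtype.val : ↥(S₁ ∪ S₂) → X))) ∧
    Nat.card (Quotient ((MulAction.orbitRel Φ X).comap (Subtype.val : ↥(S₁ ∪ S₂) → X))) =
      Nat.card (Quotient ((MulAction.orbitRel Φ X).comap (Subtype.val : S₁ → X))) +
        Nat.card (Quotient ((MulAction.orbitRel Φ X).comap (Subtype.val : S₂ → X))) := by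
  set R := (MulAction.orbitRel Φ X).comap (Subtype.val : ↥(S₁ ∪ S₂) → X) with hR
  set R₁ := (MulAction.orbitRel Φ X).comap (Subtype.val : S₁ → X) with hR₁
  set R₂ := (MulAction.orbitRel Φ X).comap (Subtype.val : S₂ → X) with hR₂
  let ι₁ : S₁ → ↥(S₁ ∪ S₂) := fun s => ⟨s, Set.mem_union_left _ s.2⟩
  let ι₂ : S₂ → ↥(S₁ ∪ S₂) := fun s => ⟨s, Set.mem_union_right _ s.2⟩
  have hresp₁ : ∀ a b : S₁, R₁ a b → R (ι₁ a) (ι₁ b) := fun a b h => by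
    rw [hR₁, orbitRel_comap_subtype_iff] at h; rw [hR, orbitRel_comap_subtype_iff]; exact h
  have hresp₂ : ∀ a b : S₂, R₂ a b → R (ι₂ a) (ι₂ b) := fun a b h => by
    rw [hR₂, orbitRel_comap_subtype_iff] at h; rw [hR, orbitRel_comap_subtype_iff]; exact h
  let F : Quotient R₁ ⊕ Quotient R₂ → Quotient R := Sum.elim (Quotient.map ι₁ hresp₁) (Quotient.map ι₂ hresp₂)
  -- no orbit meets both pieces
  have hsep : ∀ (a : S₁) (b : S₂), ¬ R (ι₁ a) (ι₂ b) := fun a b h => by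
    rw [hR, orbitRel_comap_subtype_iff] at h
    obtain ⟨φ, hφ⟩ := h
    have hb : (b : X) = φ⁻¹ • (a : X) := by rw [← hφ, inv_smul_smul]
    exact Set.disjoint_left.1 hdisj (hinv φ⁻¹ a a.2) (hb ▸ b.2)
  have hF : Function.Bijective F := by
    refine ⟨fun p q h => ?_, fun q => ?_⟩
    · rcases p with p | p <;> rcases q with q | q
      · induction p using Quotient.inductionOn with
        | h a => induction q using Quotient.inductionOn with
          | h b =>
            have h' : R (ι₁ a) (ι₁ b) := Quotient.exact h
            rw [hR, orbitRel_comap_subtype_iff] at h'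
            exact congrArg Sum.inl (Quotient.sound ((orbitRel_comap_subtype_iff S₁ a b).2 h'))
      · induction p using Quotient.inductionOn with
        | h a => induction q using Quotient.inductionOn with
          | h b => exact absurd (Quotient.exact h) (hsep a b)
      · induction p using Quotient.inductionOn with
        | h a => induction q using Quotient.inductionOn with
          | h b => exact absurd (Quotient.exact h.symm) (hsep b a)
      · induction p using Quotient.inductionOn with
        | h a => induction q using Quotient.inductionOn with
          | h b =>
            have h' : R (ι₂ a) (ι₂ b) := Quotient.exact h
            rw [hR, orbitRel_comap_subtype_iff] at h'
            exact congrArg Sum.inr (Quotient.sound ((orbitRel_comap_subtype_iff S₂ a b).2 h'))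
    · induction q using Quotient.inductionOn with
      | h c =>
        rcases (Set.mem_union _ _ _).1 c.2 with hc | hc
        · exact ⟨Sum.inl (Quotient.mk R₁ ⟨c, hc⟩), rfl⟩
        · exact ⟨Sum.inr (Quotient.mk R₂ ⟨c, hc⟩), rfl⟩
  haveI : Finite (Quotient R₁) := h₁
  haveI : Finite (Quotient R₂) := h₂
  exact ⟨Finite.of_surjective F hF.2, by rw [← Nat.card_eq_of_bijective F hF, Nat.card_sum]⟩

end Transfer

/-! ## §2 The tube count -/

section Tube

variable {Φ : Type*} [Group Φ] {𝓐 𝓑 : Type*} [MulAction Φ 𝓐] [MulAction Φ 𝓑]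

/-- **THE TUBE COUNT («per period, off-axis fixed vertices = off-axis fixed flags»).**  Data: `adj : 𝓑 → 𝓐 → Prop` (`Φ`-invariant), fixed sets `F_𝓐 ⊆ 𝓐`, `F_𝓑 ⊆ 𝓑`
and axis sets `Y_𝓐 ⊆ F_𝓐`, `Y_𝓑 ⊆ F_𝓑` (all `Φ`-invariant), heights `h_𝓐, h_𝓑` and PARENTS `p_𝓐 : 𝓐 → 𝓑`, `p_𝓑 : 𝓑 → 𝓐` (`Φ`-equivariant) with: an off-axis fixed
vertex has an adjacent fixed parent exactly one level lower, and EVERY fixed flag not inside the axis is a parent flag (tree-ness toward the axis).  Then, with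
`Fl = {(b,a) | adj b a, b ∈ F_𝓑, a ∈ F_𝓐}` the fixed flags and `Fl_Y = {(b,a) | adj b a, b ∈ Y_𝓑, a ∈ Y_𝓐}` the axis flags, all orbit quotients finite as soon as
`#(F_𝓐∕Φ), #(F_𝓑∕Φ), #(Fl∕Φ)` are:
`#(F_𝓐∕Φ) + #(F_𝓑∕Φ) + #(Fl_Y∕Φ) = #(Fl∕Φ) + #(Y_𝓐∕Φ) + #(Y_𝓑∕Φ)`. [cite: Serre1980Trees, I.6.4 Prop. 24–25] [cite: Kottwitz1988, §2 Theorem 2] -/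
theorem natCard_quotient_tube (adj : 𝓑 → 𝓐 → Prop) (hadj : ∀ (φ : Φ) (b : 𝓑) (a : 𝓐), adj (φ • b) (φ • a) ↔ adj b a)
    (FA YA : Set 𝓐) (FB YB : Set 𝓑) (hYA : YA ⊆ FA) (hYB : YB ⊆ FB)
    (hFAi : ∀ (φ : Φ) (a : 𝓐), a ∈ FA → φ • a ∈ FA) (hFBi : ∀ (φ : Φ) (b : 𝓑), b ∈ FB → φ • b ∈ FB)
    (hYAi : ∀ (φ : Φ) (a : 𝓐), a ∈ YA → φ • a ∈ YA) (hYBi : ∀ (φ : Φ) (b : 𝓑), b ∈ YB → φ • b ∈ YB)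
    (hA : 𝓐 → ℕ) (hB : 𝓑 → ℕ) (pA : 𝓐 → 𝓑) (pB : 𝓑 → 𝓐)
    (hpAeq : ∀ (φ : Φ) (a : 𝓐), a ∈ FA → a ∉ YA → pA (φ • a) = φ • pA a)
    (hpBeq : ∀ (φ : Φ) (b : 𝓑), b ∈ FB → b ∉ YB → pB (φ • b) = φ • pB b)
    (hpA : ∀ a : 𝓐, a ∈ FA → a ∉ YA → adj (pA a) a ∧ pA a ∈ FB ∧ hB (pA a) + 1 = hA a)
    (hpB : ∀ b : 𝓑, b ∈ FB → b ∉ YB → adj b (pB b) ∧ pB b ∈ FA ∧ hA (pB b) + 1 = hB b)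
    (hedge : ∀ (b : 𝓑) (a : 𝓐), adj b a → b ∈ FB → a ∈ FA → ¬ (b ∈ YB ∧ a ∈ YA) → (a ∉ YA ∧ pA a = b) ∨ (b ∉ YB ∧ pB b = a))
    (hfinA : Finite (Quotient ((MulAction.orbitRel Φ 𝓐).comap (Subtype.val : FA → 𝓐))))
    (hfinB : Finite (Quotient ((MulAction.orbitRel Φ 𝓑).comap (Subtype.val : FB → 𝓑))))
    (hfinF : Finite (Quotient ((MulAction.orbitRel Φ (𝓑 × 𝓐)).comap
      (Subtype.val : {p : 𝓑 × 𝓐 | adj p.1 p.2 ∧ p.1 ∈ FB ∧ p.2 ∈ FA} → 𝓑 × 𝓐)))) :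
    Nat.card (Quotient ((MulAction.orbitRel Φ 𝓐).comap (Subtype.val : FA → 𝓐))) +
        Nat.card (Quotient ((MulAction.orbitRel Φ 𝓑).comap (Subtype.val : FB → 𝓑))) +
        Nat.card (Quotient ((MulAction.orbitRel Φ (𝓑 × 𝓐)).comap
          (Subtype.val : {p : 𝓑 × 𝓐 | adj p.1 p.2 ∧ p.1 ∈ YB ∧ p.2 ∈ YA} → 𝓑 × 𝓐))) =
      Nat.card (Quotient ((MulAction.orbitRel Φ (𝓑 × 𝓐)).comap
          (Subtype.val : {p : 𝓑 × 𝓐 | adj p.1 p.2 ∧ p.1 ∈ FB ∧ p.2 ∈ FA} → 𝓑 × 𝓐))) +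
        Nat.card (Quotient ((MulAction.orbitRel Φ 𝓐).comap (Subtype.val : YA → 𝓐))) +
        Nat.card (Quotient ((MulAction.orbitRel Φ 𝓑).comap (Subtype.val : YB → 𝓑))) := by
  -- the pieces
  set offA : Set 𝓐 := FA \ YA with hoffA
  set offB : Set 𝓑 := FB \ YB with hoffB
  set Fl : Set (𝓑 × 𝓐) := {p : 𝓑 × 𝓐 | adj p.1 p.2 ∧ p.1 ∈ FB ∧ p.2 ∈ FA} with hFl
  set FlY : Set (𝓑 × 𝓐) := {p : 𝓑 × 𝓐 | adj p.1 p.2 ∧ p.1 ∈ YB ∧ p.2 ∈ YA} with hFlY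
  set offFl : Set (𝓑 × 𝓐) := Fl \ FlY with hoffFl
  set downFl : Set (𝓑 × 𝓐) := {p : 𝓑 × 𝓐 | p ∈ Fl ∧ p.2 ∉ YA ∧ pA p.2 = p.1} with hdownFl
  set upFl : Set (𝓑 × 𝓐) := {p : 𝓑 × 𝓐 | p ∈ Fl ∧ p.1 ∉ YB ∧ pB p.1 = p.2} with hupFl
  -- (a) the off-axis flags split into down-flags and up-flags
  have hdu_disj : Disjoint downFl upFl := by
    rw [Set.disjoint_left]
    rintro ⟨b, a⟩ ⟨hp, haY, hpa⟩ ⟨-, hbY, hpb⟩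
    simp only at haY hpa hbY hpb
    have h1 := (hpA a hp.2.2 haY).2.2
    have h2 := (hpB b hp.2.1 hbY).2.2
    rw [hpa] at h1; rw [hpb] at h2
    omega
  have hoff_eq : offFl = downFl ∪ upFl := by
    ext ⟨b, a⟩
    simp only [hoffFl, hdownFl, hupFl, hFlY, Set.mem_sdiff, Set.mem_union, Set.mem_setOf_eq]
    constructor
    · rintro ⟨hp, hnot⟩
      have hnot' : ¬ (b ∈ YB ∧ a ∈ YA) := fun h => hnot ⟨hp.1, h.1, h.2⟩
      rcases hedge b a hp.1 hp.2.1 hp.2.2 hnot' with ⟨haY, hpa⟩ | ⟨hbY, hpb⟩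
      · exact Or.inl ⟨hp, haY, hpa⟩
      · exact Or.inr ⟨hp, hbY, hpb⟩
    · rintro (⟨hp, haY, -⟩ | ⟨hp, hbY, -⟩)
      · exact ⟨hp, fun h => haY h.2.2⟩
      · exact ⟨hp, fun h => hbY h.2.1⟩
  -- (b) invariance of the pieces
  have hoffAi : ∀ (φ : Φ) (a : 𝓐), a ∈ offA → φ • a ∈ offA := fun φ a ha =>
    ⟨hFAi φ a ha.1, fun h => ha.2 (by simpa using hYAi φ⁻¹ _ h)⟩
  have hoffBi : ∀ (φ : Φ) (b : 𝓑), b ∈ offB → φ • b ∈ offB := fun φ b hb =>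
    ⟨hFBi φ b hb.1, fun h => hb.2 (by simpa using hYBi φ⁻¹ _ h)⟩
  have hdownFli : ∀ (φ : Φ) (p : 𝓑 × 𝓐), p ∈ downFl → φ • p ∈ downFl := by
    rintro φ ⟨b, a⟩ ⟨⟨hadj', hb, ha⟩, haY, hpa⟩
    simp only at hadj' hb ha haY hpa
    refine ⟨⟨(hadj φ b a).2 hadj', hFBi φ b hb, hFAi φ a ha⟩, fun h => haY (by simpa using hYAi φ⁻¹ _ h), ?_⟩
    show pA (φ • a) = φ • b
    rw [hpAeq φ a ha haY, hpa]
  have hoffFli : ∀ (φ : Φ) (p : 𝓑 × 𝓐), p ∈ offFl → φ • p ∈ offFl := by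
    rintro φ ⟨b, a⟩ ⟨⟨hadj', hb, ha⟩, hnot⟩
    refine ⟨⟨(hadj φ b a).2 hadj', hFBi φ b hb, hFAi φ a ha⟩, fun h => hnot ⟨hadj', ?_, ?_⟩⟩
    · simpa using hYBi φ⁻¹ _ h.2.1
    · simpa using hYAi φ⁻¹ _ h.2.2
  -- (c) the equivariant bijections `offA ≃ downFl`, `offB ≃ upFl`
  have hbijA := natCard_quotient_orbitRel_comap_eq_of_bijective (Φ := Φ) offA downFl
    (fun a => ⟨(pA a, (a : 𝓐)), ⟨(hpA a a.2.1 a.2.2).1, (hpA a a.2.1 a.2.2).2.1, a.2.1⟩, a.2.2, rfl⟩)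
    ⟨fun a a' h => Subtype.ext (congrArg Prod.snd (congrArg Subtype.val h)), fun p => ⟨⟨p.1.2, p.2.1.2.2, p.2.2.1⟩,
      Subtype.ext (Prod.ext (by simpa using p.2.2.2) rfl)⟩⟩
    (fun s t => ⟨fun ⟨φ, hφ⟩ => ⟨φ, by
        show φ • (pA t, (t : 𝓐)) = (pA s, (s : 𝓐))
        rw [Prod.smul_mk, ← hpAeq φ t t.2.1 t.2.2, hφ]⟩,
      fun ⟨φ, hφ⟩ => ⟨φ, by simpa using congrArg Prod.snd hφ⟩⟩)
  have hbijB := natCard_quotient_orbitRel_comap_eq_of_bijective (Φ := Φ) offB upFl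
    (fun b => ⟨((b : 𝓑), pB b), ⟨(hpB b b.2.1 b.2.2).1, b.2.1, (hpB b b.2.1 b.2.2).2.1⟩, b.2.2, rfl⟩)
    ⟨fun b b' h => Subtype.ext (congrArg Prod.fst (congrArg Subtype.val h)), fun p => ⟨⟨p.1.1, p.2.1.2.1, p.2.2.1⟩,
      Subtype.ext (Prod.ext rfl (by simpa using p.2.2.2))⟩⟩
    (fun s t => ⟨fun ⟨φ, hφ⟩ => ⟨φ, by
        show φ • ((t : 𝓑), pB t) = ((s : 𝓑), pB s)
        rw [Prod.smul_mk, ← hpBeq φ t t.2.1 t.2.2, hφ]⟩,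
      fun ⟨φ, hφ⟩ => ⟨φ, by simpa using congrArg Prod.fst hφ⟩⟩)
  -- (d) finiteness of every piece
  have hfinoffA := finite_quotient_orbitRel_comap_of_subset (Φ := Φ) (show offA ⊆ FA from Set.sdiff_subset) hfinA
  have hfinoffB := finite_quotient_orbitRel_comap_of_subset (Φ := Φ) (show offB ⊆ FB from Set.sdiff_subset) hfinB
  have hfinYA := finite_quotient_orbitRel_comap_of_subset (Φ := Φ) hYA hfinA
  have hfinYB := finite_quotient_orbitRel_comap_of_subset (Φ := Φ) hYB hfinB
  have hFlY_sub : FlY ⊆ Fl := fun p hp => ⟨hp.1, hYB hp.2.1, hYA hp.2.2⟩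
  have hfinFlY := finite_quotient_orbitRel_comap_of_subset (Φ := Φ) hFlY_sub hfinF
  have hfindown : Finite _ := hbijA.2.1 hfinoffA
  have hfinup : Finite _ := hbijB.2.1 hfinoffB
  -- (e) additivity
  have hsplitA := natCard_quotient_orbitRel_comap_union (Φ := Φ) offA YA Set.disjoint_sdiff_left hoffAi hfinoffA hfinYA
  have hsplitB := natCard_quotient_orbitRel_comap_union (Φ := Φ) offB YB Set.disjoint_sdiff_left hoffBi hfinoffB hfinYB
  have hsplitFl := natCard_quotient_orbitRel_comap_union (Φ := Φ) downFl upFl hdu_disj hdownFli hfindown hfinup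
  have hoffFl_fin : Finite (Quotient ((MulAction.orbitRel Φ (𝓑 × 𝓐)).comap (Subtype.val : offFl → 𝓑 × 𝓐))) := by
    rw [hoff_eq]; exact hsplitFl.1
  have hsplitF := natCard_quotient_orbitRel_comap_union (Φ := Φ) offFl FlY Set.disjoint_sdiff_left hoffFli hoffFl_fin hfinFlY
  have hFA_eq : offA ∪ YA = FA := Set.sdiff_union_of_subset hYA
  have hFB_eq : offB ∪ YB = FB := Set.sdiff_union_of_subset hYB
  have hFl_eq : offFl ∪ FlY = Fl := Set.sdiff_union_of_subset hFlY_sub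
  rw [hFA_eq] at hsplitA
  rw [hFB_eq] at hsplitB
  rw [hFl_eq] at hsplitF
  rw [hsplitA.2, hsplitB.2, hsplitF.2, hoff_eq, hsplitFl.2, hbijA.1, hbijB.1]
  omega

end Tube

end Literature.GroupTheory
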